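import Literature.NumberTheory.Automorphic.UnitaryGroupAdelicCharactersDet
import Literature.NumberTheory.Automorphic.RelNormOneTorusArchDivisible
import Literature.NumberTheory.Automorphic.UnitaryGroupAdelicProduct
import HarnessLib

/-!
# Automatic continuity of characters of `U(J)(𝔸_F)`: from a finite-adelic level and the archimedean centre

Topic `NumberTheory/Automorphic`; namespace `Literature.NumberTheory.Automorphic.UnitaryGroup` (§1 general
`E/F`, `c`, `N`, `J`; §2 the CM rank-three diagonal case, sub-namespace `AdelicContinuity`).

[GelbartRogawski1991, §3.1 Remark p. 457 L4–13]: two compatible splittings of the dual pair differ by a character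
of `G(𝔸)`, `G = U(3)`, and "a character of `G` is an automorphic character of `E¹` regarded as a character of `G`"
(through `det`).  The tree proves the second clause for CONTINUOUS characters
(`UnitaryGroup.AdelicCharactersDet.eq_comp_sec_comp_adelicDet`, hypothesis `hχ : Continuous χ`), whereas the character
produced from a SMOOTH compatible splitting
(`GelbartRogawski1991.UnitaryDualPair.WeilCoinv.exists_eq_twist_openKer_of_smooth`) is an ABSTRACT homomorphism known
only to kill an open subgroup of the finite-adelic group.  This file supplies the missing continuity statement.

* §1 (`G(𝔸) = G_∞ × G(𝔸_f)`, [BorelJacquet1979, §4.1]).  For any `E/F`, `c`, `N`, `J` and any topological monoid `A`: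
  a homomorphism `χ : U(J)(𝔸_F) →* A` is continuous iff its restrictions along `archToAdelic` and `finAdelicToAdelic`
  are (`continuous_iff_continuous_comp_arch_fin`, `continuous_of_continuous_comp_arch_fin`); a homomorphism on
  `U(J)(𝔸_{F,f})` (or on any topological group) killing an OPEN subgroup is continuous
  (`continuous_of_isOpen_of_forall_map_eq_one`, [Bourbaki1995, Chap. III §2 no. 8 Prop. 23]).
* §2 (CM field `L`, `F = L⁺`, `J = diagonal d` real nonsingular of rank `3`, `A` a commutative topological group).
  An abstract `χ : U(J)(𝔸_{L⁺}) →* A` which kills an open subgroup of `U(J)(𝔸_{L⁺,f})` and whose restriction to the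
  ARCHIMEDEAN CENTRE `U(1)(L⁺ ⊗ ℝ) · 1₃` is continuous IS continuous (`continuous_of_level_of_continuous_centre`), and
  its archimedean part is `α ∘ det_∞` with `α` continuous (`exists_continuous_arch_eq_comp_cmArchDet`).  Assembly, nothing
  else: at `∞` an abstract homomorphism kills every element all of whose complex components have determinant one
  (`AdelicCharactersDet.arch_apply_eq_one`: `SU(3)` and `SU(2,1)` are perfect), so it factors through
  `det_∞ : U(J)(L ⊗ ℝ) → U(1)(L⁺ ⊗ ℝ)`, whose restriction to the centre is the cube map of a compact divisible torus —
  a quotient map (`continuous_of_forall_det_eq_one`, `exists_continuous_comp_cmArchDet_eq'`,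
  [Bourbaki1995, Chap. I §3 no. 4 Prop. 6]); §1 glues the two components.  For `A = ℂˣ` the conclusion feeds
  `AdelicCharactersDet.eq_comp_sec_comp_adelicDet` verbatim (`eq_comp_sec_comp_adelicDet_of_level_of_continuous_centre`).

CAUTION (recorded, not used): without the hypothesis on the centre the statement is false — `U(1)(L⁺) \ U(1)(𝔸_{L⁺}) / K_f`
is a compact torus of positive dimension, which carries discontinuous abstract characters; continuity on the centre is
exactly what a central-type condition at `∞` provides.

Theorems only: 0 definitions, 0 named facts, 0 `sorry`.

## References
* [BorelJacquet1979] A. Borel, H. Jacquet, *Automorphic forms and automorphic representations*, Proc. Sympos. Pure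
  Math. 33 Part 1 (1979), §4.1 (`G(𝐀) = G_∞ × G(𝐀_f)`).
* [Bourbaki1995] N. Bourbaki, *General Topology, Chapters 1–4*, Springer 1995: Chap. I §3 no. 4 Prop. 6 (maps out of a
  quotient space), Chap. III §2 no. 8 Prop. 23 (a homomorphism continuous at one point is continuous).
* [GelbartRogawski1991] S. Gelbart, J. Rogawski, *L-functions and Fourier–Jacobi coefficients for the unitary group
  U(3)*, Invent. Math. 105 (1991), §3.1 Remark p. 457 L4–13.
-/

set_option autoImplicit false

noncomputable section

open NumberField

namespace Literature.NumberTheory.Automorphic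

namespace UnitaryGroup

/-! ## §1 Continuity on `U(J)(𝔸_F)` from the archimedean and finite components -/

section General

variable (F E : Type) [Field F] [NumberField F] [Field E] [NumberField E] [Algebra F E]
  (c : E ≃ₐ[F] E) (N : ℕ) (J : Matrix (Fin N) (Fin N) E)

/-- **A homomorphism out of a topological group which kills an open subgroup is continuous** (it is constant on the
cosets of that subgroup, hence locally constant). [cite: Bourbaki1995, Chap. III §2 no. 8 Prop. 23] -/
theorem continuous_of_isOpen_of_forall_map_eq_one {G A : Type*} [Group G] [TopologicalSpace G] [ContinuousMul G]
    [Monoid A] [TopologicalSpace A] (χ : G →* A) (K : Subgroup G) (hK : IsOpen (K : Set G))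
    (h1 : ∀ k ∈ K, χ k = 1) : Continuous χ := by
  refine continuous_iff_continuousAt.2 fun g => ?_
  have hU : IsOpen {h : G | g⁻¹ * h ∈ (K : Set G)} := hK.preimage (continuous_const.mul continuous_id)
  have hgU : g ∈ {h : G | g⁻¹ * h ∈ (K : Set G)} := by
    simp only [Set.mem_setOf_eq, inv_mul_cancel, SetLike.mem_coe]
    exact K.one_mem
  refine (continuousAt_const (y := χ g)).congr_of_eventuallyEq ?_
  filter_upwards [hU.mem_nhds hgU] with h hh
  calc χ h = χ (g * (g⁻¹ * h)) := by rw [mul_inv_cancel_left]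
    _ = χ g * χ (g⁻¹ * h) := map_mul χ _ _
    _ = χ g := by rw [h1 _ hh, mul_one]

/-- **`g = (g_∞, 1) · (1, g_f)`: a homomorphism on `U(J)(𝔸_F)` whose restrictions along `archToAdelic` and
`finAdelicToAdelic` are continuous is continuous** (`A` any topological monoid). [cite: BorelJacquet1979, §4.1] -/
theorem continuous_of_continuous_comp_arch_fin {A : Type*} [Monoid A] [TopologicalSpace A] [ContinuousMul A]
    (χ : (adelicGroupData F E c N J).Adelic →* A) (harch : Continuous (χ.comp (archToAdelic F E c N J)))
    (hfin : Continuous (χ.comp (finAdelicToAdelic F E c N J))) : Continuous χ := by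
  refine ((harch.comp (continuous_archPart F E c N J)).mul (hfin.comp (continuous_finPart F E c N J))).congr
    fun g => ?_
  show χ (archToAdelic F E c N J (archPart F E c N J g)) * χ (finAdelicToAdelic F E c N J (finPart F E c N J g)) = χ g
  rw [← map_mul, archToAdelic_mul_finAdelicToAdelic]

/-- **`χ` is continuous on `U(J)(𝔸_F)` iff `χ ∘ archToAdelic` and `χ ∘ finAdelicToAdelic` are.**
[cite: BorelJacquet1979, §4.1] -/
theorem continuous_iff_continuous_comp_arch_fin {A : Type*} [Monoid A] [TopologicalSpace A] [ContinuousMul A]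
    (χ : (adelicGroupData F E c N J).Adelic →* A) :
    Continuous χ ↔
      Continuous (χ.comp (archToAdelic F E c N J)) ∧ Continuous (χ.comp (finAdelicToAdelic F E c N J)) :=
  ⟨fun h => ⟨h.comp (continuous_archToAdelic F E c N J), h.comp (continuous_finAdelicToAdelic F E c N J)⟩,
    fun h => continuous_of_continuous_comp_arch_fin F E c N J χ h.1 h.2⟩

/-- **Level form**: a homomorphism on `U(J)(𝔸_F)` which kills an open subgroup of `U(J)(𝔸_{F,f})` and whose
archimedean restriction is continuous is continuous. [cite: BorelJacquet1979, §4.1] -/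
theorem continuous_of_level_of_continuous_comp_archToAdelic {A : Type*} [Monoid A] [TopologicalSpace A]
    [ContinuousMul A] (χ : (adelicGroupData F E c N J).Adelic →* A)
    (harch : Continuous (χ.comp (archToAdelic F E c N J)))
    (hlev : ∃ K : Subgroup (finAdelic F E c N J), IsOpen (K : Set (finAdelic F E c N J)) ∧
      ∀ k ∈ K, χ (finAdelicToAdelic F E c N J k) = 1) : Continuous χ := by
  obtain ⟨K, hK, h1⟩ := hlev
  exact continuous_of_continuous_comp_arch_fin F E c N J χ harch
    (continuous_of_isOpen_of_forall_map_eq_one (χ.comp (finAdelicToAdelic F E c N J)) K hK h1)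

end General

/-! ## §2 The CM rank-three diagonal case: continuity from a level and the archimedean centre -/

namespace AdelicContinuity

variable (L : Type) [Field L] [NumberField L] [IsCMField L] {A : Type*} [CommGroup A] [TopologicalSpace A]
variable (d : Fin 3 → L) (hd : ∀ i, IsCMField.complexConj L (d i) = d i) (hd0 : ∀ i, d i ≠ 0)

omit [NumberField L] [IsCMField L] in
include hd0 in
/-- `det (diagonal d) ≠ 0` for an entrywise nonzero `d`. [folklore] -/
private theorem det_diagonal_ne_zero : (Matrix.diagonal d).det ≠ 0 := by
  rw [Matrix.det_diagonal]
  exact Finset.prod_ne_zero_iff.2 fun i _ => hd0 i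

include hd hd0 in
/-- **Archimedean part.** An ABSTRACT homomorphism `θ : U(J)(L ⊗ ℝ) →* A` (`J = diagonal d` real nonsingular, rank `3`;
`A` a commutative topological group) whose restriction to the centre `U(1)(L⁺ ⊗ ℝ) · 1₃` is continuous is continuous:
it kills every element with determinant-one complex components (`AdelicCharactersDet.arch_apply_eq_one`) and
`det_∞` restricted to the centre is the cube map of a divisible compact torus (`continuous_of_forall_det_eq_one`).
[cite: GelbartRogawski1991, §3.1 Remark p. 457] -/
theorem arch_continuous_of_continuous_centre
    (θ : ↥(UnitaryGroup.arch (↥(maximalRealSubfield L)) L (IsCMField.complexConj L) 3 (Matrix.diagonal d)) →* A)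
    (hcen : Continuous fun y => θ (cmArchCenter L 3 (Matrix.diagonal d) y)) : Continuous θ :=
  continuous_of_forall_det_eq_one L 3 (Matrix.diagonal d) (det_diagonal_ne_zero L d hd0) (by decide) θ
    (fun a ha => AdelicCharactersDet.arch_apply_eq_one L d hd hd0 θ a ha) hcen

include hd hd0 in
/-- **Archimedean part, factorised form**: under the same hypotheses `θ = α ∘ det_∞` with `α : U(1)(L⁺ ⊗ ℝ) →* A`
CONTINUOUS (`exists_continuous_comp_cmArchDet_eq'`). [cite: GelbartRogawski1991, §3.1 Remark p. 457] -/
theorem arch_exists_continuous_eq_comp_cmArchDet (hJ : (Matrix.diagonal d).det ≠ 0)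
    (θ : ↥(UnitaryGroup.arch (↥(maximalRealSubfield L)) L (IsCMField.complexConj L) 3 (Matrix.diagonal d)) →* A)
    (hcen : Continuous fun y => θ (cmArchCenter L 3 (Matrix.diagonal d) y)) :
    ∃ α : relNormOneInfUnits (↥(maximalRealSubfield L)) L →* A,
      Continuous α ∧ θ = α.comp (cmArchDet L 3 (Matrix.diagonal d) hJ) :=
  exists_continuous_comp_cmArchDet_eq' L 3 (Matrix.diagonal d) hJ (by decide) θ
    (fun a ha => AdelicCharactersDet.arch_apply_eq_one L d hd hd0 θ a ha) hcen

include hd hd0 in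
/-- **Automatic continuity on `U(J)(𝔸_{L⁺})`** (`J = diagonal d` real nonsingular of rank `3`, `A` a commutative
topological group): an abstract homomorphism `χ : U(J)(𝔸_{L⁺}) →* A` whose finite-adelic restriction is continuous and
whose restriction to the ARCHIMEDEAN CENTRE `y ↦ χ ((y · 1₃, 1))` is continuous is continuous.
[cite: GelbartRogawski1991, §3.1 Remark p. 457] -/
theorem continuous_of_continuous_fin_of_continuous_centre [ContinuousMul A]
    (χ : ↥(UnitaryGroup.adelic (↥(maximalRealSubfield L)) L (IsCMField.complexConj L) 3 (Matrix.diagonal d)) →* A)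
    (hfin : Continuous (χ.comp
      (finAdelicToAdelic (↥(maximalRealSubfield L)) L (IsCMField.complexConj L) 3 (Matrix.diagonal d))))
    (hcen : Continuous fun y => χ (archToAdelic (↥(maximalRealSubfield L)) L (IsCMField.complexConj L) 3
      (Matrix.diagonal d) (cmArchCenter L 3 (Matrix.diagonal d) y))) : Continuous χ :=
  continuous_of_continuous_comp_arch_fin (↥(maximalRealSubfield L)) L (IsCMField.complexConj L) 3 (Matrix.diagonal d) χ
    (arch_continuous_of_continuous_centre L d hd hd0
      (χ.comp (archToAdelic (↥(maximalRealSubfield L)) L (IsCMField.complexConj L) 3 (Matrix.diagonal d))) hcen)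
    hfin

include hd hd0 in
/-- **Automatic continuity, level form** — the shape delivered by a SMOOTH compatible splitting
(`WeilCoinv.exists_eq_twist_openKer_of_smooth`: `twistCharV ĉ = 1` on an open `K_f`): an abstract homomorphism
`χ : U(J)(𝔸_{L⁺}) →* A` which kills an open subgroup of `U(J)(𝔸_{L⁺,f})` and is continuous on the archimedean centre
is continuous. [cite: GelbartRogawski1991, §3.1 Remark p. 457] -/
theorem continuous_of_level_of_continuous_centre [ContinuousMul A]
    (χ : ↥(UnitaryGroup.adelic (↥(maximalRealSubfield L)) L (IsCMField.complexConj L) 3 (Matrix.diagonal d)) →* A)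
    (hlev : ∃ K : Subgroup ↥(UnitaryGroup.finAdelic (↥(maximalRealSubfield L)) L (IsCMField.complexConj L) 3
        (Matrix.diagonal d)),
      IsOpen (K : Set ↥(UnitaryGroup.finAdelic (↥(maximalRealSubfield L)) L (IsCMField.complexConj L) 3
        (Matrix.diagonal d))) ∧
      ∀ k ∈ K, χ (finAdelicToAdelic (↥(maximalRealSubfield L)) L (IsCMField.complexConj L) 3 (Matrix.diagonal d) k) = 1)
    (hcen : Continuous fun y => χ (archToAdelic (↥(maximalRealSubfield L)) L (IsCMField.complexConj L) 3
      (Matrix.diagonal d) (cmArchCenter L 3 (Matrix.diagonal d) y))) : Continuous χ := by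
  obtain ⟨K, hK, h1⟩ := hlev
  exact continuous_of_continuous_fin_of_continuous_centre L d hd hd0 χ
    (continuous_of_isOpen_of_forall_map_eq_one _ K hK h1) hcen

include hd hd0 in
/-- **The archimedean part of such a `χ` factors through `det_∞` with a CONTINUOUS character of `U(1)(L⁺ ⊗ ℝ)`.**
[cite: GelbartRogawski1991, §3.1 Remark p. 457] -/
theorem exists_continuous_arch_eq_comp_cmArchDet (hJ : (Matrix.diagonal d).det ≠ 0)
    (χ : ↥(UnitaryGroup.adelic (↥(maximalRealSubfield L)) L (IsCMField.complexConj L) 3 (Matrix.diagonal d)) →* A)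
    (hcen : Continuous fun y => χ (archToAdelic (↥(maximalRealSubfield L)) L (IsCMField.complexConj L) 3
      (Matrix.diagonal d) (cmArchCenter L 3 (Matrix.diagonal d) y))) :
    ∃ α : relNormOneInfUnits (↥(maximalRealSubfield L)) L →* A, Continuous α ∧
      χ.comp (archToAdelic (↥(maximalRealSubfield L)) L (IsCMField.complexConj L) 3 (Matrix.diagonal d)) =
        α.comp (cmArchDet L 3 (Matrix.diagonal d) hJ) :=
  arch_exists_continuous_eq_comp_cmArchDet L d hd hd0 hJ _ hcen

include hd hd0 in
/-- **Junction with `AdelicCharactersDet.eq_comp_sec_comp_adelicDet`** (`A = ℂˣ`): an abstract character of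
`U(J)(𝔸_{L⁺})` of some finite level, continuous on the archimedean centre, equals `(χ ∘ sec) ∘ det` for ANY section
`sec` of `adelicDet` — [GelbartRogawski1991, §3.1 Remark p. 457 L9–13] "regarded as a character of `G`" with the
continuity hypothesis discharged. [cite: GelbartRogawski1991, §3.1 Remark p. 457] -/
theorem eq_comp_sec_comp_adelicDet_of_level_of_continuous_centre (hJ : (Matrix.diagonal d).det ≠ 0)
    (sec : ↥(UnitaryGroup.adelicOne (↥(maximalRealSubfield L)) L (IsCMField.complexConj L)) →*
      ↥(UnitaryGroup.adelic (↥(maximalRealSubfield L)) L (IsCMField.complexConj L) 3 (Matrix.diagonal d)))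
    (hsec : ∀ u, UnitaryGroup.adelicDet (↥(maximalRealSubfield L)) L (IsCMField.complexConj L) 3 (Matrix.diagonal d) hJ
      (sec u) = u)
    (χ : ↥(UnitaryGroup.adelic (↥(maximalRealSubfield L)) L (IsCMField.complexConj L) 3 (Matrix.diagonal d)) →* ℂˣ)
    (hlev : ∃ K : Subgroup ↥(UnitaryGroup.finAdelic (↥(maximalRealSubfield L)) L (IsCMField.complexConj L) 3
        (Matrix.diagonal d)),
      IsOpen (K : Set ↥(UnitaryGroup.finAdelic (↥(maximalRealSubfield L)) L (IsCMField.complexConj L) 3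
        (Matrix.diagonal d))) ∧
      ∀ k ∈ K, χ (finAdelicToAdelic (↥(maximalRealSubfield L)) L (IsCMField.complexConj L) 3 (Matrix.diagonal d) k) = 1)
    (hcen : Continuous fun y => χ (archToAdelic (↥(maximalRealSubfield L)) L (IsCMField.complexConj L) 3
      (Matrix.diagonal d) (cmArchCenter L 3 (Matrix.diagonal d) y))) :
    Continuous χ ∧
      χ = (χ.comp sec).comp
        (UnitaryGroup.adelicDet (↥(maximalRealSubfield L)) L (IsCMField.complexConj L) 3 (Matrix.diagonal d) hJ) :=
  have hχ := continuous_of_level_of_continuous_centre L d hd hd0 χ hlev hcen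
  ⟨hχ, AdelicCharactersDet.eq_comp_sec_comp_adelicDet L d hd hd0 hJ sec hsec χ hχ⟩

end AdelicContinuity

end UnitaryGroup

end Literature.NumberTheory.Automorphic

end
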